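import Summits.AtomisticToContinuum.Crystallization.Theorems.ChartedPlanarOrderLayerFrame

/-!
# ChartedPlanarOrder — layer geometry of a stacked layered set (`StackedLayerGeometry`)

decomp-a2c lens-3 (generation 23/24; N = `Theses.ChartedPlanarOrder.ChartedZeroExcessLayered`, PS column).
Elementary pieces of the layering dichotomy `StackedDichotomy` (critic row 445), kept free of the pattern tables:

* §1 NUMERICS: decimal brackets for `√6`, `√2`; the tilt budget `(1 − c²)·g ≤ 289/16384` ⇒ `c ≥ 0.976`
  (triangular, `g = 24704/65536`) / `c ≥ 0.988` (square, `g = 49536/65536`); deviation budgets `|d| ≤ 1/4, 1/8,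
  11/100`; the HEIGHT WINDOWS `H = a′(κ c + d) + e`: triangular up-site `≤ 101/100·a′`, class `+h` `≥ 12/25·a′`,
  class `−h` `< 0`; square up-site `≤ 9/10·a′`, class `+h` `≥ a′/2`, class `2h` `> 9/10·a′`, negatives `< 0`.
* §2 GRAM LOWER BOUNDS `‖a‖²‖b‖² − ⟪a,b⟫² ≥ g·a′⁴` from the period data of `…CleanEnvironment.periods_type`.
* §3 LAYERED-SET LEMMAS: period shifts, heights of atoms, `H_{m+1} ≤` every positive atom height above layer `m`,
  and a layer-`(m+1)` atom within planar distance `(‖a‖+‖b‖)/2` of `w m` (lattice reduction).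
* §4 FRAME TRANSFER through the environment isometry `A`: tilt input `|⟪A n, a⟫| ≤ ‖a − a′ A p‖`, the height
  deviation `(⟪ν, A z⟫ − ⟪n,z⟫⟪ν, A n⟫)² ≤ (1 − ⟪ν,A n⟫²)(‖z‖² − ⟪n,z⟫²)`, and the height split.
-/

open MeasureTheory Set Metric
open scoped RealInnerProductSpace
open Summit.AtomisticToContinuum.Crystallization.Theorems.ChartedPlanarOrderRigidityDoor (E3)
open Summit.AtomisticToContinuum.Crystallization.Theorems.ChartedPlanarOrderDoorLayered (Layered)
open Summit.AtomisticToContinuum.Crystallization.Theorems.ChartedPlanarOrderNashForceBalance (strictMono_height)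
open Summit.AtomisticToContinuum.Crystallization.Theorems.ChartedPlanarOrderLayerFrame

namespace Summit.AtomisticToContinuum.Crystallization.Theorems.ChartedPlanarOrderStackedLayerGeometry

/-! ## §1 Numerics -/

/-- `2.4494 < √6 < 2.4498`. -/
theorem sqrt_six_bounds : (24494 : ℝ) / 10000 < Real.sqrt 6 ∧ Real.sqrt 6 < 24498 / 10000 := by
  constructor
  · rw [Real.lt_sqrt (by norm_num)]; norm_num
  · rw [Real.sqrt_lt' (by norm_num)]; norm_num

/-- `1.4142 < √2 < 1.4143`. -/
theorem sqrt_two_bounds : (14142 : ℝ) / 10000 < Real.sqrt 2 ∧ Real.sqrt 2 < 14143 / 10000 := by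
  constructor
  · rw [Real.lt_sqrt (by norm_num)]; norm_num
  · rw [Real.sqrt_lt' (by norm_num)]; norm_num

/-- `(√6/3)² = 2/3`. -/
theorem sq_sqrt_six_div : (Real.sqrt 6 / 3) ^ 2 = 2 / 3 := by
  rw [div_pow, Real.sq_sqrt (by norm_num)]; norm_num

/-- `(√2/2)² = 1/2`. -/
theorem sq_sqrt_two_div : (Real.sqrt 2 / 2) ^ 2 = 1 / 2 := by
  rw [div_pow, Real.sq_sqrt (by norm_num)]; norm_num

/-- `(2·(√2/2))² = 2`. -/
theorem sq_two_mul_sqrt_two_div : (2 * (Real.sqrt 2 / 2)) ^ 2 = 2 := by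
  rw [mul_pow, sq_sqrt_two_div]; norm_num

/-- a cosine with `c² ≤ 1` is at most `1`. -/
theorem le_one_of_sq_le_one {c : ℝ} (hc : c ^ 2 ≤ 1) : c ≤ 1 :=
  (abs_le_of_sq_le_sq' (by rw [one_pow]; exact hc) zero_le_one).2

/-- the reach budget: planar offset `≤ 17a′/16` and height `≤ 1.01 a′` fit in the environment ball `3a′/2`. -/
theorem reach_budget {s t a' D : ℝ} (hs0 : 0 ≤ s) (hs : s ≤ 17 / 16 * a') (ht0 : 0 ≤ t)
    (ht : t ≤ 101 / 100 * a') (hD : D ≤ s ^ 2 + t ^ 2) : D ≤ (3 / 2 * a') ^ 2 := by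
  have h1 : s ^ 2 ≤ (17 / 16 * a') ^ 2 := pow_le_pow_left₀ hs0 hs 2
  have h2 : t ^ 2 ≤ (101 / 100 * a') ^ 2 := pow_le_pow_left₀ ht0 ht 2
  nlinarith [sq_nonneg a']

/-- the triangular type clause: `|⟪a,b⟫ − a′² κ| ≤ r`, `κ = ±1/2`, `r ≤ a′²/2` ⇒ `| |⟪a,b⟫| − a′²/2 | ≤ r`. -/
theorem abs_abs_sub_half {I a' κ : ℝ} (hκ : κ = 1 / 2 ∨ κ = -1 / 2) (h : |I - a' ^ 2 * κ| ≤ 33 / 256 * a' ^ 2) :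
    |(|I| - a' ^ 2 / 2)| ≤ 33 / 256 * a' ^ 2 := by
  have ha2 : 0 ≤ a' ^ 2 := sq_nonneg a'
  have h1 := abs_le.1 h
  rcases hκ with rfl | rfl
  · have hpos : 0 ≤ I := by linarith [h1.1]
    rw [abs_of_nonneg hpos, abs_le]; constructor <;> linarith [h1.1, h1.2]
  · have hneg : I ≤ 0 := by linarith [h1.2]
    rw [abs_of_nonpos hneg, abs_le]; constructor <;> linarith [h1.1, h1.2]

/-- tilt budget ⇒ cosine bound, TRIANGULAR: `(1 − c²)·24704 ≤ 1156 ⇒ c ≥ 0.976`. -/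
theorem cos_lower_T {c : ℝ} (hc : 0 ≤ c) (hs : (1 - c ^ 2) * 24704 ≤ 1156) : 976 / 1000 ≤ c := by
  by_contra h
  rw [not_le] at h
  have h1 : c * c ≤ 976 / 1000 * c := by nlinarith
  nlinarith

/-- tilt budget ⇒ cosine bound, SQUARE: `(1 − c²)·49536 ≤ 1156 ⇒ c ≥ 0.988`. -/
theorem cos_lower_S {c : ℝ} (hc : 0 ≤ c) (hs : (1 - c ^ 2) * 49536 ≤ 1156) : 988 / 1000 ≤ c := by
  by_contra h
  rw [not_le] at h
  have h1 : c * c ≤ 988 / 1000 * c := by nlinarith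
  nlinarith

/-- deviation budget, triangular, any shell (`‖z‖² − κ² ≤ 2 − 2/3`): `|d| ≤ 1/4`. -/
theorem dev_T_any {c d : ℝ} (hs : (1 - c ^ 2) * 24704 ≤ 1156) (hd : d ^ 2 ≤ (1 - c ^ 2) * (2 - 2 / 3)) : |d| ≤ 1 / 4 :=
  abs_le_of_sq_le_sq (by nlinarith) (by norm_num)

/-- deviation budget, triangular, first shell (`‖z‖² − κ² = 1 − 2/3`): `|d| ≤ 1/8`. -/
theorem dev_T_first {c d : ℝ} (hs : (1 - c ^ 2) * 24704 ≤ 1156) (hd : d ^ 2 ≤ (1 - c ^ 2) * (1 - 2 / 3)) : |d| ≤ 1 / 8 :=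
  abs_le_of_sq_le_sq (by nlinarith) (by norm_num)

/-- deviation budget, square, first shell (`‖z‖² − κ² = 1 − 1/2`): `|d| ≤ 11/100`. -/
theorem dev_S_first {c d : ℝ} (hs : (1 - c ^ 2) * 49536 ≤ 1156) (hd : d ^ 2 ≤ (1 - c ^ 2) * (1 - 1 / 2)) : |d| ≤ 11 / 100 :=
  abs_le_of_sq_le_sq (by nlinarith) (by norm_num)

/-- a vanishing deviation (`‖z‖² = κ² = 2`). -/
theorem dev_zero {c d : ℝ} (hd : d ^ 2 ≤ (1 - c ^ 2) * (2 - 2)) : d = 0 := by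
  nlinarith [sq_nonneg d]

/-- TRIANGULAR up-site window: `a′(h c + d) + e ≤ 1.01 a′` (`h = √6/3`, `|d| ≤ 1/8`, `|e| ≤ a′/16`). -/
theorem window_T_up {a' c d e : ℝ} (ha' : 0 < a') (hc1 : c ≤ 1) (hd : |d| ≤ 1 / 8) (he : |e| ≤ 1 / 16 * a') :
    a' * (Real.sqrt 6 / 3 * c + d) + e ≤ 101 / 100 * a' := by
  have h6 := sqrt_six_bounds
  have hd' := (abs_le.1 hd).2
  have he' := (abs_le.1 he).2
  have h1 : Real.sqrt 6 / 3 * c ≤ Real.sqrt 6 / 3 := by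
    have : 0 ≤ Real.sqrt 6 / 3 := by positivity
    nlinarith
  have hsum : Real.sqrt 6 / 3 * c + d ≤ 9416 / 10000 := by linarith
  nlinarith [mul_le_mul_of_nonneg_left hsum ha'.le]

/-- TRIANGULAR class `+h` window: `0.48 a′ ≤ a′(h c + d) + e` (`c ≥ 0.976`, `|d| ≤ 1/4`). -/
theorem window_T_low {a' c d e : ℝ} (ha' : 0 < a') (hc : 976 / 1000 ≤ c) (hd : |d| ≤ 1 / 4) (he : |e| ≤ 1 / 16 * a') :
    12 / 25 * a' ≤ a' * (Real.sqrt 6 / 3 * c + d) + e := by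
  have h6 := sqrt_six_bounds
  have hd' := (abs_le.1 hd).1
  have he' := (abs_le.1 he).1
  have h1 : (24494 : ℝ) / 30000 * c ≤ Real.sqrt 6 / 3 * c := by
    apply mul_le_mul_of_nonneg_right _ (by linarith); linarith [h6.1]
  have h2 : (24494 : ℝ) / 30000 * (976 / 1000) ≤ 24494 / 30000 * c := by
    apply mul_le_mul_of_nonneg_left hc; norm_num
  have hsum : 5468 / 10000 ≤ Real.sqrt 6 / 3 * c + d := by linarith
  nlinarith [mul_le_mul_of_nonneg_left hsum ha'.le]

/-- TRIANGULAR class `−h`: negative height. -/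
theorem window_T_neg {a' c d e : ℝ} (ha' : 0 < a') (hc : 976 / 1000 ≤ c) (hd : |d| ≤ 1 / 4) (he : |e| ≤ 1 / 16 * a') :
    a' * (-(Real.sqrt 6 / 3) * c + d) + e < 0 := by
  have h6 := sqrt_six_bounds
  have hd' := (abs_le.1 hd).2
  have he' := (abs_le.1 he).2
  have h1 : (24494 : ℝ) / 30000 * c ≤ Real.sqrt 6 / 3 * c := by
    apply mul_le_mul_of_nonneg_right _ (by linarith); linarith [h6.1]
  have h2 : (24494 : ℝ) / 30000 * (976 / 1000) ≤ 24494 / 30000 * c := by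
    apply mul_le_mul_of_nonneg_left hc; norm_num
  have hsum : -(Real.sqrt 6 / 3) * c + d ≤ -(5468 / 10000) := by linarith
  nlinarith [mul_le_mul_of_nonneg_left hsum ha'.le]

/-- SQUARE up-site window: `a′(h c + d) + e ≤ 0.9 a′` (`h = √2/2`, `|d| ≤ 0.11`). -/
theorem window_S_up {a' c d e : ℝ} (ha' : 0 < a') (hc1 : c ≤ 1) (hd : |d| ≤ 11 / 100) (he : |e| ≤ 1 / 16 * a') :
    a' * (Real.sqrt 2 / 2 * c + d) + e ≤ 9 / 10 * a' := by
  have h2 := sqrt_two_bounds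
  have hd' := (abs_le.1 hd).2
  have he' := (abs_le.1 he).2
  have h1 : Real.sqrt 2 / 2 * c ≤ Real.sqrt 2 / 2 := by
    have : 0 ≤ Real.sqrt 2 / 2 := by positivity
    nlinarith
  have hsum : Real.sqrt 2 / 2 * c + d ≤ 8172 / 10000 := by linarith
  nlinarith [mul_le_mul_of_nonneg_left hsum ha'.le]

/-- SQUARE class `+h` window: `a′/2 ≤ a′(h c + d) + e` (`c ≥ 0.988`, `|d| ≤ 0.11`). -/
theorem window_S_low {a' c d e : ℝ} (ha' : 0 < a') (hc : 988 / 1000 ≤ c) (hd : |d| ≤ 11 / 100) (he : |e| ≤ 1 / 16 * a') :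
    1 / 2 * a' ≤ a' * (Real.sqrt 2 / 2 * c + d) + e := by
  have h2 := sqrt_two_bounds
  have hd' := (abs_le.1 hd).1
  have he' := (abs_le.1 he).1
  have h1 : (14142 : ℝ) / 20000 * c ≤ Real.sqrt 2 / 2 * c := by
    apply mul_le_mul_of_nonneg_right _ (by linarith); linarith [h2.1]
  have h3 : (14142 : ℝ) / 20000 * (988 / 1000) ≤ 14142 / 20000 * c := by
    apply mul_le_mul_of_nonneg_left hc; norm_num
  have hsum : 5886 / 10000 ≤ Real.sqrt 2 / 2 * c + d := by linarith
  nlinarith [mul_le_mul_of_nonneg_left hsum ha'.le]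

/-- SQUARE class `−h`: negative height. -/
theorem window_S_neg {a' c d e : ℝ} (ha' : 0 < a') (hc : 988 / 1000 ≤ c) (hd : |d| ≤ 11 / 100) (he : |e| ≤ 1 / 16 * a') :
    a' * (-(Real.sqrt 2 / 2) * c + d) + e < 0 := by
  have h2 := sqrt_two_bounds
  have hd' := (abs_le.1 hd).2
  have he' := (abs_le.1 he).2
  have h1 : (14142 : ℝ) / 20000 * c ≤ Real.sqrt 2 / 2 * c := by
    apply mul_le_mul_of_nonneg_right _ (by linarith); linarith [h2.1]
  have h3 : (14142 : ℝ) / 20000 * (988 / 1000) ≤ 14142 / 20000 * c := by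
    apply mul_le_mul_of_nonneg_left hc; norm_num
  have hsum : -(Real.sqrt 2 / 2) * c + d ≤ -(5886 / 10000) := by linarith
  nlinarith [mul_le_mul_of_nonneg_left hsum ha'.le]

/-- SQUARE class `2h` (straight above at two spacings): height `> 0.9 a′`. -/
theorem window_S_two {a' c d e : ℝ} (ha' : 0 < a') (hc : 988 / 1000 ≤ c) (hd : d = 0) (he : |e| ≤ 1 / 16 * a') :
    9 / 10 * a' < a' * (2 * (Real.sqrt 2 / 2) * c + d) + e := by
  have h2 := sqrt_two_bounds
  have he' := (abs_le.1 he).1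
  have h1 : (14142 : ℝ) / 10000 * c ≤ 2 * (Real.sqrt 2 / 2) * c := by
    apply mul_le_mul_of_nonneg_right _ (by linarith); linarith [h2.1]
  have h3 : (14142 : ℝ) / 10000 * (988 / 1000) ≤ 14142 / 10000 * c := by
    apply mul_le_mul_of_nonneg_left hc; norm_num
  have hsum : 13972 / 10000 ≤ 2 * (Real.sqrt 2 / 2) * c + d := by rw [hd]; linarith
  nlinarith [mul_le_mul_of_nonneg_left hsum ha'.le]

/-- SQUARE class `−2h`: negative height. -/
theorem window_S_negtwo {a' c d e : ℝ} (ha' : 0 < a') (hc : 988 / 1000 ≤ c) (hd : d = 0) (he : |e| ≤ 1 / 16 * a') :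
    a' * (-(2 * (Real.sqrt 2 / 2)) * c + d) + e < 0 := by
  have h2 := sqrt_two_bounds
  have he' := (abs_le.1 he).2
  have h1 : (14142 : ℝ) / 10000 * c ≤ 2 * (Real.sqrt 2 / 2) * c := by
    apply mul_le_mul_of_nonneg_right _ (by linarith); linarith [h2.1]
  have h3 : (14142 : ℝ) / 10000 * (988 / 1000) ≤ 14142 / 10000 * c := by
    apply mul_le_mul_of_nonneg_left hc; norm_num
  have hsum : -(2 * (Real.sqrt 2 / 2)) * c + d ≤ -(13972 / 10000) := by rw [hd]; linarith
  nlinarith [mul_le_mul_of_nonneg_left hsum ha'.le]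

/-- the tilt budget: `(1 − c²) G ≤ (a′/16 (‖a‖+‖b‖))²`, `G ≥ g a′⁴`, `‖a‖, ‖b‖ ≤ 17a′/16` ⇒ `(1 − c²) g ≤ 289/16384`. -/
theorem tilt_budget {c G na nb a' g : ℝ} (ha' : 0 < a') (hc : c ^ 2 ≤ 1) (ht : (1 - c ^ 2) * G ≤ (1 / 16 * a' * (na + nb)) ^ 2)
    (hG : g * a' ^ 4 ≤ G) (hna : na ≤ 17 / 16 * a') (hnb : nb ≤ 17 / 16 * a') (hna0 : 0 ≤ na) (hnb0 : 0 ≤ nb) :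
    (1 - c ^ 2) * g ≤ 289 / 16384 := by
  have h1 : (1 - c ^ 2) * (g * a' ^ 4) ≤ (1 - c ^ 2) * G := mul_le_mul_of_nonneg_left hG (by linarith)
  have h2 : (1 / 16 * a' * (na + nb)) ^ 2 ≤ (1 / 16 * a' * (17 / 8 * a')) ^ 2 := by
    apply pow_le_pow_left₀ (by positivity)
    apply mul_le_mul_of_nonneg_left _ (by positivity); linarith
  have h3 : (1 - c ^ 2) * g * a' ^ 4 ≤ 289 / 16384 * a' ^ 4 := by nlinarith
  exact le_of_mul_le_mul_right h3 (pow_pos ha' 4)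

/-! ## §2 Gram lower bounds from the period data -/

/-- TRIANGULAR: `‖a‖²‖b‖² − ⟪a,b⟫² ≥ (24704/65536) a′⁴`. -/
theorem gram_lower_T {a b : E3} {a' κ : ℝ} (ha' : 0 < a') (ha : |‖a‖ - a'| ≤ 1 / 16 * a') (hb : |‖b‖ - a'| ≤ 1 / 16 * a')
    (hκ : κ = 1 / 2 ∨ κ = -1 / 2) (hab : |⟪a, b⟫ - a' ^ 2 * κ| ≤ 33 / 256 * a' ^ 2) :
    24704 / 65536 * a' ^ 4 ≤ ‖a‖ ^ 2 * ‖b‖ ^ 2 - ⟪a, b⟫ ^ 2 := by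
  have ha1 : 15 / 16 * a' ≤ ‖a‖ := by have := (abs_le.1 ha).1; linarith
  have hb1 : 15 / 16 * a' ≤ ‖b‖ := by have := (abs_le.1 hb).1; linarith
  have hA : (15 / 16 * a') ^ 2 ≤ ‖a‖ ^ 2 := pow_le_pow_left₀ (by positivity) ha1 2
  have hB : (15 / 16 * a') ^ 2 ≤ ‖b‖ ^ 2 := pow_le_pow_left₀ (by positivity) hb1 2
  have hAB : (15 / 16 * a') ^ 2 * (15 / 16 * a') ^ 2 ≤ ‖a‖ ^ 2 * ‖b‖ ^ 2 :=
    mul_le_mul hA hB (by positivity) (by positivity)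
  have hI : |⟪a, b⟫| ≤ 161 / 256 * a' ^ 2 := by
    have h1 := abs_le.1 hab
    rcases hκ with rfl | rfl <;> rw [abs_le] <;> constructor <;> nlinarith [h1.1, h1.2]
  have hI2 : ⟪a, b⟫ ^ 2 ≤ (161 / 256 * a' ^ 2) ^ 2 := by
    rw [← sq_abs]; exact pow_le_pow_left₀ (abs_nonneg _) hI 2
  nlinarith

/-- SQUARE: `‖a‖²‖b‖² − ⟪a,b⟫² ≥ (49536/65536) a′⁴`. -/
theorem gram_lower_S {a b : E3} {a' : ℝ} (ha' : 0 < a') (ha : |‖a‖ - a'| ≤ 1 / 16 * a') (hb : |‖b‖ - a'| ≤ 1 / 16 * a')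
    (hab : |⟪a, b⟫ - a' ^ 2 * 0| ≤ 33 / 256 * a' ^ 2) :
    49536 / 65536 * a' ^ 4 ≤ ‖a‖ ^ 2 * ‖b‖ ^ 2 - ⟪a, b⟫ ^ 2 := by
  have ha1 : 15 / 16 * a' ≤ ‖a‖ := by have := (abs_le.1 ha).1; linarith
  have hb1 : 15 / 16 * a' ≤ ‖b‖ := by have := (abs_le.1 hb).1; linarith
  have hA : (15 / 16 * a') ^ 2 ≤ ‖a‖ ^ 2 := pow_le_pow_left₀ (by positivity) ha1 2
  have hB : (15 / 16 * a') ^ 2 ≤ ‖b‖ ^ 2 := pow_le_pow_left₀ (by positivity) hb1 2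
  have hAB : (15 / 16 * a') ^ 2 * (15 / 16 * a') ^ 2 ≤ ‖a‖ ^ 2 * ‖b‖ ^ 2 :=
    mul_le_mul hA hB (by positivity) (by positivity)
  have hI : |⟪a, b⟫| ≤ 33 / 256 * a' ^ 2 := by simpa using hab
  have hI2 : ⟪a, b⟫ ^ 2 ≤ (33 / 256 * a' ^ 2) ^ 2 := by
    rw [← sq_abs]; exact pow_le_pow_left₀ (abs_nonneg _) hI 2
  nlinarith

/-! ## §3 Layered-set lemmas -/

section Layers

variable {a b ν : E3} {w : ℤ → E3}

/-- period shifts preserve the layered set. -/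
theorem sub_period_mem {y : E3} (hy : y ∈ Layered a b w) (i j : ℤ) :
    y - ((i : ℝ) • a + (j : ℝ) • b) ∈ Layered a b w := by
  obtain ⟨m, i₀, j₀, rfl⟩ := hy
  refine ⟨m, i₀ - i, j₀ - j, ?_⟩
  push_cast
  simp only [sub_smul]
  abel

/-- period shifts preserve the layered set (additive form). -/
theorem add_period_mem {y : E3} (hy : y ∈ Layered a b w) (i j : ℤ) :
    y + ((i : ℝ) • a + (j : ℝ) • b) ∈ Layered a b w := by
  obtain ⟨m, i₀, j₀, rfl⟩ := hy
  refine ⟨m, i₀ + i, j₀ + j, ?_⟩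
  push_cast
  simp only [add_smul]
  abel

/-- the layer offset `w m` is an atom. -/
theorem offset_mem (m : ℤ) : w m ∈ Layered a b w := ⟨m, 0, 0, by simp⟩

/-- the height of an atom of layer `m` is the height of `w m`. -/
theorem inner_eq_of_layer (hνa : ⟪ν, a⟫ = 0) (hνb : ⟪ν, b⟫ = 0) {y : E3} {m i j : ℤ}
    (hy : y = ((i : ℝ) • a + (j : ℝ) • b) + w m) : ⟪ν, y⟫ = ⟪ν, w m⟫ := by
  rw [hy, inner_add_right, inner_add_right, inner_smul_right, inner_smul_right, hνa, hνb]; ring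

/-- a period combination is horizontal. -/
theorem inner_period_combo (hνa : ⟪ν, a⟫ = 0) (hνb : ⟪ν, b⟫ = 0) (s t : ℝ) : ⟪ν, s • a + t • b⟫ = 0 := by
  rw [inner_add_right, inner_smul_right, inner_smul_right, hνa, hνb]; ring

/-- ★ the NEXT layer is the lowest: every atom strictly above layer `m` is at least `H_{m+1}` above it. -/
theorem next_height_le (hν : ∀ m : ℤ, 0 < ⟪ν, w (m + 1) - w m⟫) (hνa : ⟪ν, a⟫ = 0) (hνb : ⟪ν, b⟫ = 0)
    {y : E3} (hy : y ∈ Layered a b w) (m : ℤ) (hpos : 0 < ⟪ν, y - w m⟫) :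
    ⟪ν, w (m + 1) - w m⟫ ≤ ⟪ν, y - w m⟫ := by
  obtain ⟨m', i, j, rfl⟩ := hy
  have hmono := strictMono_height (w := w) hν
  have hy' : ⟪ν, ((i : ℝ) • a + (j : ℝ) • b) + w m'⟫ = ⟪ν, w m'⟫ := inner_eq_of_layer hνa hνb rfl
  rw [inner_sub_right, hy'] at hpos
  rw [inner_sub_right, inner_sub_right, hy']
  have hlt : m < m' := hmono.lt_iff_lt.1 (by linarith)
  have hle : (fun l => ⟪ν, w l⟫) (m + 1) ≤ (fun l => ⟪ν, w l⟫) m' := hmono.monotone (by omega)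
  simp only at hle
  linarith

/-- ★ a layer-`(m+1)` atom close to `w m`: planar offset at most `(‖a‖+‖b‖)/2` (lattice reduction), height `H_{m+1}`. -/
theorem exists_next_layer_atom (hν1 : ‖ν‖ = 1) (hνa : ⟪ν, a⟫ = 0) (hνb : ⟪ν, b⟫ = 0)
    (hG : 0 < ‖a‖ ^ 2 * ‖b‖ ^ 2 - ⟪a, b⟫ ^ 2) (m : ℤ) :
    ∃ y ∈ Layered a b w, ⟪ν, y - w m⟫ = ⟪ν, w (m + 1) - w m⟫ ∧
      ‖y - w m‖ ^ 2 ≤ ((‖a‖ + ‖b‖) / 2) ^ 2 + ⟪ν, w (m + 1) - w m⟫ ^ 2 := by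
  set H := ⟪ν, w (m + 1) - w m⟫ with hH
  set t := (w (m + 1) - w m) - H • ν with ht
  have hνt : ⟪ν, t⟫ = 0 := (norm_sq_eq_planar_add_height hν1 (w (m + 1) - w m)).1
  obtain ⟨i, j, hij⟩ := exists_lattice_reduction hν1 hνa hνb hνt hG
  refine ⟨w (m + 1) - ((i : ℝ) • a + (j : ℝ) • b), sub_period_mem (offset_mem (m + 1)) i j, ?_, ?_⟩
  · have h0 := inner_period_combo hνa hνb (i : ℝ) (j : ℝ)
    rw [show w (m + 1) - ((i : ℝ) • a + (j : ℝ) • b) - w m = (w (m + 1) - w m) - ((i : ℝ) • a + (j : ℝ) • b) by abel,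
      inner_sub_right, h0, sub_zero]
  · have hdec : w (m + 1) - ((i : ℝ) • a + (j : ℝ) • b) - w m = (t - ((i : ℝ) • a + (j : ℝ) • b)) + H • ν := by
      rw [ht]; abel
    have hνt' : ⟪ν, t - ((i : ℝ) • a + (j : ℝ) • b)⟫ = 0 := by
      rw [inner_sub_right, hνt, inner_period_combo hνa hνb, sub_zero]
    rw [hdec, norm_sq_add_smul_normal hν1 hνt' H]
    have := pow_le_pow_left₀ (norm_nonneg _) hij 2
    linarith

end Layers

/-! ## §4 Frame transfer through the environment isometry -/

section Frame

variable {A : E3 →ₗᵢ[ℝ] E3}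

/-- tilt input: `⟪n, p⟫ = 0` and `‖x − a′ A p‖ ≤ r` give `|⟪A n, x⟫| ≤ r` for a unit `n`. -/
theorem abs_inner_map_le {n p x : E3} {a' r : ℝ} (hn : ‖n‖ = 1) (hnp : ⟪n, p⟫ = 0) (hx : ‖x - a' • A p‖ ≤ r) :
    |⟪A n, x⟫| ≤ r := by
  have h : ⟪A n, x⟫ = ⟪A n, x - a' • A p⟫ := by
    rw [inner_sub_right, inner_smul_right, LinearIsometry.inner_map_map, hnp, mul_zero, sub_zero]
  rw [h]
  refine (abs_real_inner_le_norm _ _).trans ?_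
  rw [LinearIsometry.norm_map, hn, one_mul]; exact hx

/-- `‖A n‖ = 1`. -/
theorem norm_map_unit {n : E3} (hn : ‖n‖ = 1) : ‖A n‖ = 1 := by rw [LinearIsometry.norm_map, hn]

/-- the cosine `c = ⟪ν, A n⟫` of two unit vectors has `c² ≤ 1`. -/
theorem cos_sq_le_one {ν n : E3} (hν : ‖ν‖ = 1) (hn : ‖n‖ = 1) : ⟪ν, A n⟫ ^ 2 ≤ 1 := by
  have h := abs_real_inner_le_norm ν (A n)
  rw [norm_map_unit hn, hν, one_mul] at h
  have := abs_le.1 h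
  nlinarith [this.1, this.2]

/-- ★ HEIGHT DEVIATION: `(⟪ν, A z⟫ − ⟪n, z⟫·⟪ν, A n⟫)² ≤ (1 − ⟪ν, A n⟫²)(‖z‖² − ⟪n, z⟫²)`. -/
theorem height_dev {ν n : E3} (hν : ‖ν‖ = 1) (hn : ‖n‖ = 1) (z : E3) :
    (⟪ν, A z⟫ - ⟪n, z⟫ * ⟪ν, A n⟫) ^ 2 ≤ (1 - ⟪ν, A n⟫ ^ 2) * (‖z‖ ^ 2 - ⟪n, z⟫ ^ 2) := by
  have := height_transfer hν (norm_map_unit (A := A) hn) (A z)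
  rwa [LinearIsometry.inner_map_map, LinearIsometry.norm_map] at this

/-- HEIGHT SPLIT of an atom offset: `⟪ν, x⟫ = a′ ⟪ν, A z⟫ + ⟪ν, x − a′ A z⟫`. -/
theorem height_split (ν x z : E3) (a' : ℝ) : ⟪ν, x⟫ = a' * ⟪ν, A z⟫ + ⟪ν, x - a' • A z⟫ := by
  rw [inner_sub_right, inner_smul_right]; ring

/-- the matching error has small height: `|⟪ν, e⟫| ≤ ‖e‖`. -/
theorem abs_inner_le_norm' {ν e : E3} (hν : ‖ν‖ = 1) {r : ℝ} (he : ‖e‖ ≤ r) : |⟪ν, e⟫| ≤ r :=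
  (abs_real_inner_le_norm ν e).trans (by rw [hν, one_mul]; exact he)

/-- the deviation budget specialised: `‖z‖² ≤ 2`, class `κ` with `κ² = k` ⇒ `d² ≤ (1 − c²)(2 − k)`; and first shell. -/
theorem dev_sq_le {ν n z : E3} (hν : ‖ν‖ = 1) (hn : ‖n‖ = 1) {B : ℝ} (hz : ‖z‖ ^ 2 ≤ B) :
    (⟪ν, A z⟫ - ⟪n, z⟫ * ⟪ν, A n⟫) ^ 2 ≤ (1 - ⟪ν, A n⟫ ^ 2) * (B - ⟪n, z⟫ ^ 2) := by
  refine (height_dev hν hn z).trans (mul_le_mul_of_nonneg_left (by linarith) ?_)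
  have := cos_sq_le_one (A := A) hν hn
  linarith

end Frame

end Summit.AtomisticToContinuum.Crystallization.Theorems.ChartedPlanarOrderStackedLayerGeometry
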